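import Summits.BirchSwinnertonDyer.Rank1Residual.X11a.Cells
import Summits.BirchSwinnertonDyer.Rank1Residual.X11a.MainConjecture
import Literature.NumberTheory.EllipticCurves.Wuthrich2014.ThreeAdicImage
import HarnessLib

/-!
# Class X11a at EVERY odd multiplicative prime (in particular `p = 3`, sub-cell `CellThree`): the
# converse chain under `p`-ADIC surjectivity, and `CellThree` made exact via Wuthrich's Lemma 20
# (cell `b2b-bsdres`, unit `b2b-bsdres-x11a`, gen 13)

HONEST FRAMING (run/shared/lean/b2b/bsd-rank1-residual/, verbatim in every file): the goal of the
cell is to DELETE the COMBINATION-SHAPED residual classes of the Birch–Swinnerton-Dyer formula for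
ALL analytic-rank `≤ 1` elliptic curves over `ℚ` — "full BSD formula for every rank `≤ 1` curve in
class `C`" assembled STRICTLY from published theorems — so that the rank-`≤ 1` remainder becomes
exactly the CONSTRUCTION-SHAPED classes, which are TYPED (missing-input `Prop`s), NOT attempted.
This is not "finishing BSD". Research routes; NO CLAIM BEYOND STATED CLASSES. Theorems only.

`X11a/MainConjecture.lean` proves the converse chain (`BSD(E,p)` ⟹ Mazur's main conjecture at
`(E,p)`) for `p ≥ 5`, where the image hypothesis of Kato's divisibility
(`Wuthrich2014.kato_charIdeal_dvd_multiplicative_of_surjective`: EVERY `ρ̄_{E,p^n}` onto) follows from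
`ρ̄_{E,p}` onto by Serre. This file states the same chain for ANY odd multiplicative prime with the
`p`-adic surjectivity as an explicit hypothesis (`mazurMainConjectureAt_of_padicValRat_le_of_surjective_pow`,
`…_of_bsdp_of_surjective_pow`, `mazurMainConjectureAt_iff_bsdp_of_surjective_pow`; the proof is that
of the `p ≥ 5` file verbatim — kept there unchanged for its consumers), and discharges it at
`p = 3` by **Wuthrich, Doc. Math. 19 (2014) Lemma 20** (named fact `lemma20_surjective_threeAdic_of_semistable`,
PUB: `3² ∤ N` and `ρ̄_{E,3}` onto ⇒ `ρ_{E,3^∞}` onto; at a multiplicative `3` the level hypothesis is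
local and holds). Consequences for X11a's sub-cell `CellThree` (`ClassX11a W p ∧ p = 3`; owner of the
`p = 3` clause of X11 is x11b/x11c, `Typed/X11Three.lean`; this file only records what the x11a chain
gives there):
* `CellThree.bsdp_of_surj_of_shaAnUnit` — the PUBLISHED part at `3`: `ρ̄_{E,3}` onto and `3 ∤ #Ш_an`
  ⇒ `BSD(E,3)` (Wuthrich Prop. 21 is printed for every odd non-additive `p`; x11a gen 1
  `bsdp_of_classX11_rankZero_surj_of_shaAn_unit`). Census (`Typed/X11Three.lean`): 15 of the 17
  rank-`0` X11 pairs at `3` with `N < 10⁴`; the other two (`5808h1`, `8664o1`, `#Ш_an = 9`) are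
  per-pair Cassels–Tate certificates (x11b).
* `CellThree.mazurMainConjectureAt_iff_bsdp_of_surj` — on `CellThree ∧ Surj W 3` the typed input
  `X2.MazurMainConjectureAt W 3` is EXACT (Lemma 20 `h20` + the chain); and
  `CellThree.mazurMainConjectureAt_of_surj_of_shaAnUnit` — Mazur's main conjecture at `(E,3)` as a
  THEOREM of the published record + Prop. 21 on those 15 pairs (no (ram)).

References: [Wuthrich2014] Lemma 20 (p. 399), Prop. 21 (p. 400), Thm. 3, Cor. 19; [GreenbergLNM1716]
§4–5; [SteinWuthrich2013] Thm. 6.1; [GreenbergStevens1993]; [MazurTateTeitelbaum1986] §I.14–15;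
[Skinner2016PacificMC] Thm. A, C; [Miller2011LMS] Def. 1.1.
-/

set_option autoImplicit false

noncomputable section

open scoped Classical MatrixGroups ModularForm

open CongruenceSubgroup WeierstrassCurve Literature.NumberTheory.EllipticCurves
  Literature.NumberTheory.EllipticCurves.ModularForms
  Literature.NumberTheory.EllipticCurves.Rank1Residual
  Literature.NumberTheory.EllipticCurves.Rank1Residual.Typed
  Literature.NumberTheory.EllipticCurves.Wuthrich2014
  Literature.NumberTheory.EllipticCurves.SteinWuthrich2013

namespace Summit.BirchSwinnertonDyer.Rank1Residual.X11a

/-! ### The converse chain at any odd multiplicative prime, `p`-adic surjectivity as a hypothesis -/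

/-- **`BSD`-type lower bound ⟹ Mazur's main conjecture at an ODD multiplicative prime with
surjective `ρ_{E,p^∞}` (every `ρ̄_{E,p^n}` onto), analytic rank `0` (core form).** Same statement,
hypotheses and proof as `mazurMainConjectureAt_of_padicValRat_le` (`X11a/MainConjecture.lean`) with
"`p ≥ 5` and `ρ̄_{E,p}` onto" replaced by "`p ≠ 2` and every `ρ̄_{E,p^n}` onto" — the image hypothesis
of Kato's divisibility as printed by Wuthrich (Thm. 3 / Cor. 19, first case).
[cite: GreenbergLNM1716, §4 (PDF pp. 112–113) and §5 (closing examples)]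
[cite: Wuthrich2014, Thm. 3 (p. 382) and Cor. 19 proof (p. 399)]
[cite: SteinWuthrich2013, Thm. 6.1 (p. 20) and §4.2] [cite: GreenbergStevens1993, Thm. (trivial zero)]
[cite: MazurTateTeitelbaum1986, §I.14–I.15] -/
theorem mazurMainConjectureAt_of_padicValRat_le_of_surjective_pow
    (hKato : kato_charIdeal_dvd_multiplicative_of_surjective)
    (hJs : thm61_splitMultiplicative) (hJn : thm61_nonsplitMultiplicative)
    (hHs : exists_isSplitMultCanonical) (hHn : exists_isMultCanonical)
    (hGZK : rank_eq_analyticRank_of_analyticRank_le_one) (hmod : hasEntireLFunction_rat)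
    (W : WeierstrassCurve ℚ) [W.IsElliptic] [W.IsGloballyMinimal] (p : ℕ) [Fact p.Prime]
    (hGS : greenberg_stevens (W := W) (p := p))
    (hp2 : p ≠ 2) (hmult : W.HasMultiplicativeReductionAtPrime p)
    (hsurj' : ∀ n : ℕ, W.HasSurjectiveModNGaloisRep (p ^ n : ℕ)) (hr : W.analyticRank = 0)
    (hlow : ∀ t : ℚ, W.entireLFunction 1 / (W.realPeriodRat : ℂ) = (t : ℂ) →
      padicValRat p t ≤ (padicValNat p W.shaOrder : ℤ) + padicValNat p W.tamagawaProduct -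
        2 * padicValNat p W.torsionOrder) :
    X2.MazurMainConjectureAt W p := by
  intro κ γ hκ hγ hγ' N _ f hf D ϖ hϖ
  have hpP : p.Prime := Fact.out
  haveI : Module.Finite (IwasawaAlgebra p) D.X := D.module_finite_holds hγ
  -- Kato's divisibility (surjective image at every level is the hypothesis)
  obtain ⟨hX, hKns, hKs⟩ := hKato W p hp2 hmult hsurj' hκ hγ hγ' hf D ϖ hϖ
  -- a generator `fE` of the (principal) characteristic ideal
  haveI : (Literature.NumberTheory.EllipticCurves.Module.charIdeal (IwasawaAlgebra p) D.X).IsPrincipal :=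
    charIdeal_isPrincipal_holds p D.X
  obtain ⟨fE, hfE⟩ := Submodule.IsPrincipal.principal
    (Literature.NumberTheory.EllipticCurves.Module.charIdeal (IwasawaAlgebra p) D.X)
  have hchar : D.charIdeal = Ideal.span {fE} := hfE
  -- rank `0`: `L(E,1) ≠ 0`, `E(ℚ)` and `Ш` finite
  have hL1 : W.entireLFunction 1 ≠ 0 := (W.analyticRank_eq_zero_iff_holds (hmod W)).1 hr
  obtain ⟨hrank, hfin⟩ := hGZK W (by omega)
  have hr0 : W.mordellWeilRank = 0 := by rw [hrank, hr]
  haveI : Finite W.toAffine.Point := W.mordellWeilRank_eq_zero_iff_finite.mp hr0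
  haveI : Finite W.sha := hfin
  haveI : Finite (AddCommGroup.primaryComponent W.sha p) := inferInstance
  -- the rational `t = ϖ · [0]⁺_f = L(E,1)/Ω_E ≠ 0` and the reverse inequality at `t`
  have hΩpos : 0 < W.realPeriodRat := W.realPeriodRat_pos_holds
  have hϖ0 : ϖ ≠ 0 := by
    rintro rfl
    have hper : 0 < plusPeriod f := IsNewform0.plusPeriod_pos_holds hf.1 hf.coeffField_eq_bot
    rw [← hϖ, Rat.cast_zero, zero_mul] at hper
    exact lt_irrefl _ hper
  set s : ℚ := ratPlusSymbol f 0 with hs_def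
  set t : ℚ := ϖ * s with ht_def
  have hLval : W.entireLFunction 1 = (((s : ℝ) * plusPeriod f : ℝ) : ℂ) := hf.entireLFunction_one_eq
  have hq : W.entireLFunction 1 / (W.realPeriodRat : ℂ) = ((t : ℚ) : ℂ) := by
    rw [hLval, ← hϖ, div_eq_iff (Complex.ofReal_ne_zero.mpr hΩpos.ne'), ht_def]
    push_cast
    ring
  have hs0 : s ≠ 0 := by
    intro h0
    apply hL1
    rw [hLval, h0]
    simp
  have ht0 : t ≠ 0 := mul_ne_zero hϖ0 hs0
  have htcast : ((t : ℚ) : ℚ_[p]) = (ϖ : ℚ_[p]) * (s : ℚ_[p]) := by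
    rw [ht_def]; push_cast; ring
  have hle := hlow t hq
  -- how a cofactor `h` with the valuation identity becomes a unit
  have unit_of_key : ∀ (h : IwasawaAlgebra p) (u : ℤ_[p]ˣ),
      PowerSeries.constantCoeff h ≠ 0 →
      (t : ℚ_[p]) * (W.torsionOrder : ℚ_[p]) ^ 2 =
        ((PowerSeries.constantCoeff h : ℤ_[p]) : ℚ_[p]) * ((u : ℤ_[p]) : ℚ_[p]) *
          (Nat.card (AddCommGroup.primaryComponent W.sha p) : ℚ_[p]) * (W.tamagawaProduct : ℚ_[p]) →
      IsUnit h := by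
    intro h u hh00 key
    set h0 : ℚ_[p] := ((PowerSeries.constantCoeff h : ℤ_[p]) : ℚ_[p]) with hh0
    have hh0ne : h0 ≠ 0 := by
      rw [hh0]
      intro h0'
      exact hh00 (by exact_mod_cast (PadicInt.coe_eq_zero.mp h0'))
    have hh0val : 0 ≤ h0.valuation := by
      rw [hh0]
      exact PadicInt.valuation_coe_nonneg
    have hval := padicValRat_eq_of_torsionSq_mul_eq_cofactor W p ht0 h0 _ hh0ne
      (valuation_coe_units_eq_zero p u) (coe_units_ne_zero p u) key
    have hh0zero : h0.valuation = 0 := by linarith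
    have hvalh : (PowerSeries.constantCoeff h : ℤ_[p]).valuation = 0 := by
      have h' : (((PowerSeries.constantCoeff h : ℤ_[p]) : ℚ_[p])).valuation = 0 := by
        rw [← hh0]; exact hh0zero
      rw [PadicInt.valuation_coe] at h'
      exact_mod_cast h'
    have hunit0 : IsUnit (PowerSeries.constantCoeff h : ℤ_[p]) := by
      rw [PadicInt.isUnit_iff, PadicInt.norm_eq_zpow_neg_valuation hh00, hvalh]
      simp
    exact PowerSeries.isUnit_iff_constantCoeff.mpr hunit0
  refine ⟨hX, fE, hchar, fun hsplit L hL => ?_, fun hns L hL => ?_⟩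
  · /- SPLIT multiplicative `p`: Kato gives `g = h · fE` with `ι(T · g) = ϖ · L`; compare
      `[T¹]`-coefficients (Greenberg–Stevens) with SW Thm. 6.1 (split, rank 0). -/
    obtain ⟨g, hgmem, hιg⟩ := hKs hsplit L hL
    have hgmem' : g ∈ Ideal.span {fE} := by rw [← hchar]; exact hgmem
    obtain ⟨h, hgh⟩ := Ideal.mem_span_singleton'.mp hgmem'
    -- data: Tate parameter, THE §4.2 height, `Reg_p = 1`, Schneider trivial
    obtain ⟨Dq⟩ := (nonempty_tateParameterData_iff_holds (W := W) (p := p)).mpr hsplit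
    obtain ⟨Dh, hDh⟩ := hHs W p hp2 Dq
    have hReg : padicRegulator Dh = 1 := padicRegulator_eq_one_of_finite W p Dh
    have hSch : SchneiderConjecture Dh := by
      rw [SchneiderConjecture, hReg]
      exact one_ne_zero
    -- SW Thm. 6.1 (split) for the generator `fE`
    obtain ⟨-, -, h3⟩ := hJs W p hp2 Dq κ γ hκ hγ hγ' D hX fE hchar Dh hDh
    obtain ⟨u, hu⟩ := h3 hSch inferInstance
    simp only [hr0, zero_add, pow_one, hReg, mul_one, PowerSeries.coeff_zero_eq_constantCoeff] at hu
    -- Greenberg–Stevens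
    obtain ⟨-, hGS1⟩ := hGS Dq hf hL
    have h𝓛0 : LInvariant Dq ≠ 0 := LInvariant_ne_zero_holds Dq
    -- `[T¹] ι(T · g) = g(0) = ϖ · [T¹] L`
    have h1 : ((PowerSeries.constantCoeff g : ℤ_[p]) : ℚ_[p]) =
        ((ϖ : ℚ) : ℚ_[p]) * PowerSeries.coeff 1 L := by
      have h := congrArg (PowerSeries.coeff 1) hιg
      rw [iwasawaToPowerSeries, PowerSeries.coeff_map, PowerSeries.coeff_succ_X_mul,
        PowerSeries.coeff_zero_eq_constantCoeff, PowerSeries.coeff_C_mul] at h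
      exact h
    -- `g(0) = h(0) · fE(0)`
    have hg0 : ((PowerSeries.constantCoeff g : ℤ_[p]) : ℚ_[p]) =
        ((PowerSeries.constantCoeff h : ℤ_[p]) : ℚ_[p]) *
          ((PowerSeries.constantCoeff fE : ℤ_[p]) : ℚ_[p]) := by
      rw [← hgh, map_mul]; push_cast; ring
    -- `g(0) ≠ 0` (since `[T¹]L · log = 𝓛 · s ≠ 0`), hence `h(0) ≠ 0`
    have hsQ0 : (s : ℚ_[p]) ≠ 0 := by exact_mod_cast hs0
    have hc1 : PowerSeries.coeff 1 L ≠ 0 := by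
      intro h0
      rw [h0, zero_mul] at hGS1
      exact (mul_ne_zero h𝓛0 hsQ0) hGS1.symm
    have hϖQ0 : ((ϖ : ℚ) : ℚ_[p]) ≠ 0 := by exact_mod_cast hϖ0
    have hh00 : PowerSeries.constantCoeff h ≠ 0 := by
      intro h0
      have : ((PowerSeries.constantCoeff g : ℤ_[p]) : ℚ_[p]) = 0 := by
        rw [hg0, h0, PadicInt.coe_zero, zero_mul]
      rw [h1] at this
      exact (mul_ne_zero hϖQ0 hc1) this
    -- the identity `t · #tors² = h(0) · u · #Ш[p^∞] · ∏ c_v` (cancel `𝓛_p`)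
    have key : (t : ℚ_[p]) * (W.torsionOrder : ℚ_[p]) ^ 2 =
        ((PowerSeries.constantCoeff h : ℤ_[p]) : ℚ_[p]) * ((u : ℤ_[p]) : ℚ_[p]) *
          (Nat.card (AddCommGroup.primaryComponent W.sha p) : ℚ_[p]) *
            (W.tamagawaProduct : ℚ_[p]) := by
      apply mul_left_cancel₀ h𝓛0
      rw [htcast]
      linear_combination (-(((ϖ : ℚ) : ℚ_[p]) * (W.torsionOrder : ℚ_[p]) ^ 2)) * hGS1 -
        (padicLog p (cyclotomicGenerator p) * (W.torsionOrder : ℚ_[p]) ^ 2) * h1 +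
        (padicLog p (cyclotomicGenerator p) * (W.torsionOrder : ℚ_[p]) ^ 2) * hg0 +
        ((PowerSeries.constantCoeff h : ℤ_[p]) : ℚ_[p]) * hu
    have hunit : IsUnit h := unit_of_key h u hh00 key
    refine ⟨hunit.unit, ?_⟩
    rw [IsUnit.unit_spec, show (PowerSeries.X : IwasawaAlgebra p) * fE * h = PowerSeries.X * g by
      rw [← hgh]; ring]
    exact hιg
  · /- NON-SPLIT multiplicative `p`: Kato gives `g = h · fE` with `ι(g) = ϖ · L`; compare constant
      coefficients (`L(0) = 2[0]⁺_f`) with SW Thm. 6.1 (non-split, rank 0). -/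
    obtain ⟨g, hgmem, hιg⟩ := hKns hns L hL
    have hgmem' : g ∈ Ideal.span {fE} := by rw [← hchar]; exact hgmem
    obtain ⟨h, hgh⟩ := Ideal.mem_span_singleton'.mp hgmem'
    -- data: Tate parameter, THE §4.2 height, `Reg_p = 1`, Schneider trivial
    obtain ⟨q, ⟨hq0, hq1, hqj⟩, -⟩ := existsUnique_tateJ_eq_of_one_lt_norm
      (one_lt_norm_j_of_hasMultiplicativeReductionAtPrime (W := W) (p := p) hmult)
    obtain ⟨Dh, hDh⟩ := hHn W p hp2 hmult hns q hq0 hq1 hqj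
    have hReg : padicRegulator Dh = 1 := padicRegulator_eq_one_of_finite W p Dh
    have hSch : SchneiderConjecture Dh := by
      rw [SchneiderConjecture, hReg]
      exact one_ne_zero
    -- SW Thm. 6.1 (non-split) for the generator `fE`
    obtain ⟨-, -, h3⟩ := hJn W p hp2 hmult hns q hq0 hq1 hqj κ γ hκ hγ hγ' D hX fE hchar Dh hDh
    obtain ⟨u, hu⟩ := h3 hSch inferInstance
    simp only [hr0, pow_zero, mul_one, hReg, PowerSeries.coeff_zero_eq_constantCoeff] at hu
    -- constant coefficients: `g(0) = ϖ · L(0) = ϖ · 2 [0]⁺_f`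
    have hL0 : PowerSeries.constantCoeff L = 2 * (s : ℚ_[p]) := hL.constantCoeff_of_neg_one
    have h1 : ((PowerSeries.constantCoeff g : ℤ_[p]) : ℚ_[p]) =
        ((ϖ : ℚ) : ℚ_[p]) * (2 * (s : ℚ_[p])) := by
      have h := congrArg PowerSeries.constantCoeff hιg
      rw [constantCoeff_iwasawaToPowerSeries, map_mul, PowerSeries.constantCoeff_C, hL0] at h
      exact h
    -- `g(0) = h(0) · fE(0)`
    have hg0 : ((PowerSeries.constantCoeff g : ℤ_[p]) : ℚ_[p]) =
        ((PowerSeries.constantCoeff h : ℤ_[p]) : ℚ_[p]) *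
          ((PowerSeries.constantCoeff fE : ℤ_[p]) : ℚ_[p]) := by
      rw [← hgh, map_mul]; push_cast; ring
    have hsQ0 : (s : ℚ_[p]) ≠ 0 := by exact_mod_cast hs0
    have hϖQ0 : ((ϖ : ℚ) : ℚ_[p]) ≠ 0 := by exact_mod_cast hϖ0
    have hh00 : PowerSeries.constantCoeff h ≠ 0 := by
      intro h0
      have : ((PowerSeries.constantCoeff g : ℤ_[p]) : ℚ_[p]) = 0 := by
        rw [hg0, h0, PadicInt.coe_zero, zero_mul]
      rw [h1] at this
      exact (mul_ne_zero hϖQ0 (mul_ne_zero two_ne_zero hsQ0)) this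
    -- the identity `t · #tors² = h(0) · u · #Ш[p^∞] · ∏ c_v` (cancel `2`)
    have key : (t : ℚ_[p]) * (W.torsionOrder : ℚ_[p]) ^ 2 =
        ((PowerSeries.constantCoeff h : ℤ_[p]) : ℚ_[p]) * ((u : ℤ_[p]) : ℚ_[p]) *
          (Nat.card (AddCommGroup.primaryComponent W.sha p) : ℚ_[p]) *
            (W.tamagawaProduct : ℚ_[p]) := by
      apply mul_left_cancel₀ (two_ne_zero : (2 : ℚ_[p]) ≠ 0)
      rw [htcast]
      linear_combination (-((W.torsionOrder : ℚ_[p]) ^ 2)) * h1 +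
        ((W.torsionOrder : ℚ_[p]) ^ 2) * hg0 +
        ((PowerSeries.constantCoeff h : ℤ_[p]) : ℚ_[p]) * hu
    have hunit : IsUnit h := unit_of_key h u hh00 key
    refine ⟨hunit.unit, ?_⟩
    rw [IsUnit.unit_spec, show fE * h = g by rw [← hgh]; ring]
    exact hιg


/-- **`BSD(E,p)` ⟹ Mazur's main conjecture at `(E,p)`** at an odd multiplicative prime with every
`ρ̄_{E,p^n}` onto, analytic rank `0` (same facts; `#Ш_an = (L(E,1)/Ω_E)·#E(ℚ)²/∏c_v` converts Miller's
clause into the reverse inequality, as in `mazurMainConjectureAt_of_missingLowerBoundAt`).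
[cite: GreenbergLNM1716, §4 (PDF pp. 112–113) and §5 (closing examples)]
[cite: Wuthrich2014, Thm. 3 (p. 382) and Cor. 19 proof (p. 399)] [cite: Miller2011LMS, Def. 1.1] -/
theorem mazurMainConjectureAt_of_bsdp_of_surjective_pow
    (hKato : kato_charIdeal_dvd_multiplicative_of_surjective)
    (hJs : thm61_splitMultiplicative) (hJn : thm61_nonsplitMultiplicative)
    (hHs : exists_isSplitMultCanonical) (hHn : exists_isMultCanonical)
    (hGZK : rank_eq_analyticRank_of_analyticRank_le_one) (hmod : hasEntireLFunction_rat)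
    (W : WeierstrassCurve ℚ) [W.IsElliptic] [W.IsGloballyMinimal] (p : ℕ) [Fact p.Prime]
    (hGS : greenberg_stevens (W := W) (p := p))
    (hp2 : p ≠ 2) (hmult : W.HasMultiplicativeReductionAtPrime p)
    (hsurj' : ∀ n : ℕ, W.HasSurjectiveModNGaloisRep (p ^ n : ℕ)) (hr : W.analyticRank = 0)
    (hbsd : BSDp W p) : X2.MazurMainConjectureAt W p := by
  have hL : W.entireLFunction 1 ≠ 0 := (W.analyticRank_eq_zero_iff_holds (hmod W)).1 hr
  haveI : Finite W.sha := (hGZK W (by rw [hr]; exact zero_le_one)).2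
  obtain ⟨q', hq', hle'⟩ := (lower_and_upper_of_missingPPartAt W p (missingPPartAt_of_bsdp W p hbsd)).1
  refine mazurMainConjectureAt_of_padicValRat_le_of_surjective_pow hKato hJs hJn hHs hHn hGZK hmod W p
    hGS hp2 hmult hsurj' hr ?_
  intro q hq
  obtain ⟨-, hE, -, hshaAn⟩ := shaAn_eq_of_L_one_div_eq hGZK W hL hq
  haveI := hE
  have hqq : q' = q * (Nat.card W.toAffine.Point : ℚ) ^ 2 / (W.tamagawaProduct : ℚ) := by
    exact_mod_cast hq'.symm.trans hshaAn
  have hΩ : (W.realPeriodRat : ℂ) ≠ 0 := by exact_mod_cast W.realPeriodRat_pos_holds.ne'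
  have hq0 : q ≠ 0 := by
    rintro rfl
    apply hL
    rw [Rat.cast_zero, div_eq_zero_iff] at hq
    exact hq.resolve_right hΩ
  have hcard : (Nat.card W.toAffine.Point : ℚ) ≠ 0 := by
    exact_mod_cast (Nat.card_pos (α := W.toAffine.Point)).ne'
  have htam : (W.tamagawaProduct : ℚ) ≠ 0 := by
    exact_mod_cast (W.tamagawaProduct_pos_holds : 0 < W.tamagawaProduct).ne'
  have hcardT : (Nat.card W.toAffine.Point : ℚ) = (W.torsionOrder : ℚ) := by
    exact_mod_cast (W.torsionOrder_eq_natCard_of_finite).symm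
  rw [hqq, padicValRat.div (mul_ne_zero hq0 (pow_ne_zero 2 hcard)) htam,
    padicValRat.mul hq0 (pow_ne_zero 2 hcard), padicValRat.pow, hcardT] at hle'
  simp only [padicValRat.of_nat, Nat.cast_ofNat] at hle'
  linarith

/-- **At an odd multiplicative prime with every `ρ̄_{E,p^n}` onto and `ord_{s=1}L(E,s) = 0`:
Mazur's main conjecture at `(E,p)` ⟺ `BSD(E,p)`** (⇒: eisenstein-p2 / x11a gen-8 glue).
[cite: GreenbergLNM1716, §4 (PDF pp. 112–113) and §5 (closing examples)] [cite: SteinWuthrich2013, Thm. 6.1 (p. 20)] -/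
theorem mazurMainConjectureAt_iff_bsdp_of_surjective_pow
    (hKato : kato_charIdeal_dvd_multiplicative_of_surjective)
    (hJs : thm61_splitMultiplicative) (hJn : thm61_nonsplitMultiplicative)
    (hHs : exists_isSplitMultCanonical) (hHn : exists_isMultCanonical)
    (hGZK : rank_eq_analyticRank_of_analyticRank_le_one) (hmod : hasEntireLFunction_rat)
    (hpar : nonempty_modularParametrizationData)
    (W : WeierstrassCurve ℚ) [W.IsElliptic] [W.IsGloballyMinimal] (p : ℕ) [Fact p.Prime]
    (hGS : greenberg_stevens (W := W) (p := p))
    (hp2 : p ≠ 2) (hmult : W.HasMultiplicativeReductionAtPrime p)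
    (hsurj' : ∀ n : ℕ, W.HasSurjectiveModNGaloisRep (p ^ n : ℕ)) (hr : W.analyticRank = 0) :
    X2.MazurMainConjectureAt W p ↔ BSDp W p :=
  ⟨X2.bsdp_of_mazurMainConjectureAt_of_analyticRank_eq_zero hJs hJn hHs hHn hGZK hmod hpar W p hGS
      hp2 hmult hr,
    mazurMainConjectureAt_of_bsdp_of_surjective_pow hKato hJs hJn hHs hHn hGZK hmod W p hGS hp2 hmult
      hsurj' hr⟩

/-! ### `p = 3`: sub-cell `CellThree` of X11a via Wuthrich's Lemma 20 -/

variable {W : WeierstrassCurve ℚ} [W.IsElliptic] [W.IsGloballyMinimal] {p : ℕ} [Fact p.Prime]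

/-- On `CellThree` (`p = 3`, multiplicative `3`) with `ρ̄_{E,3}` onto, every `ρ̄_{E,3^n}` is onto —
Wuthrich 2014 Lemma 20 (named fact `h20`; its hypothesis `3² ∤ N` is the local "good or
multiplicative at `3`"). [cite: Wuthrich2014, Lemma 20 (p. 399)] -/
theorem CellThree.surjective_pow_of_surj (h20 : lemma20_surjective_threeAdic_of_semistable)
    (h : CellThree W p) (hsurj : Surj W p) : ∀ n : ℕ, W.HasSurjectiveModNGaloisRep (p ^ n : ℕ) := by
  obtain ⟨hX, rfl⟩ := h
  exact h20 W (Or.inr hX.mult) hsurj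

/-- **`CellThree`, `ρ̄_{E,3}` onto, `3 ∤ #Ш(E/ℚ)_an` ⇒ `BSD(E,3)` from PUBLISHED theorems** (Wuthrich
Prop. 21 at the odd non-additive prime `3`, `hWu`; GZK; modularity) — the `p = 3` counterpart of
`CellPub.bsdp` (x11a gen 1 `bsdp_of_classX11_rankZero_surj_of_shaAn_unit`, printed for every odd `p`).
Census: 15 of 17 rank-`0` X11 pairs at `3`, `N < 10⁴`. [cite: Wuthrich2014, Prop. 21 (p. 400)] -/
theorem CellThree.bsdp_of_surj_of_shaAnUnit (hWu : sha_dvd_analyticSha)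
    (hGZK : rank_eq_analyticRank_of_analyticRank_le_one) (hmod : hasEntireLFunction_rat)
    (h : CellThree W p) (hsurj : Surj W p) (hunit : ShaAnUnit W p) : BSDp W p :=
  bsdp_of_classX11_rankZero_surj_of_shaAn_unit W p hWu hGZK h.1.ne_two h.1.toX11
    (h.1.L_one_ne_zero hmod) hsurj hunit

/-- **On `CellThree ∧ Surj W 3` the typed input is EXACT**: `X2.MazurMainConjectureAt W p ↔ BSDp W p`
(Lemma 20 `h20` supplies the `3`-adic surjectivity; then the chain). [cite: Wuthrich2014, Lemma 20 (p. 399)]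
[cite: GreenbergLNM1716, §4 (PDF pp. 112–113) and §5 (closing examples)] -/
theorem CellThree.mazurMainConjectureAt_iff_bsdp_of_surj
    (hKato : kato_charIdeal_dvd_multiplicative_of_surjective)
    (h20 : lemma20_surjective_threeAdic_of_semistable)
    (hJs : thm61_splitMultiplicative) (hJn : thm61_nonsplitMultiplicative)
    (hHs : exists_isSplitMultCanonical) (hHn : exists_isMultCanonical)
    (hGZK : rank_eq_analyticRank_of_analyticRank_le_one) (hmod : hasEntireLFunction_rat)
    (hpar : nonempty_modularParametrizationData)
    (hGS : greenberg_stevens (W := W) (p := p)) (h : CellThree W p) (hsurj : Surj W p) :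
    X2.MazurMainConjectureAt W p ↔ BSDp W p :=
  mazurMainConjectureAt_iff_bsdp_of_surjective_pow hKato hJs hJn hHs hHn hGZK hmod hpar W p hGS
    h.1.ne_two h.1.mult (h.surjective_pow_of_surj h20 hsurj) h.1.1

/-- **Mazur's main conjecture at `(E,3)` for every `CellThree` pair with `ρ̄_{E,3}` onto and
`3 ∤ #Ш(E/ℚ)_an`** — from PUBLISHED facts (Prop. 21 ⇒ `BSD(E,3)`, Lemma 20, and the chain); no (ram)
prime. [cite: Wuthrich2014, Lemma 20 (p. 399) and Prop. 21 (p. 400)]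
[cite: GreenbergLNM1716, §4 (PDF pp. 112–113) and §5 (closing examples)] -/
theorem CellThree.mazurMainConjectureAt_of_surj_of_shaAnUnit
    (hKato : kato_charIdeal_dvd_multiplicative_of_surjective)
    (h20 : lemma20_surjective_threeAdic_of_semistable) (hWu : sha_dvd_analyticSha)
    (hJs : thm61_splitMultiplicative) (hJn : thm61_nonsplitMultiplicative)
    (hHs : exists_isSplitMultCanonical) (hHn : exists_isMultCanonical)
    (hGZK : rank_eq_analyticRank_of_analyticRank_le_one) (hmod : hasEntireLFunction_rat)
    (hGS : greenberg_stevens (W := W) (p := p)) (h : CellThree W p) (hsurj : Surj W p)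
    (hunit : ShaAnUnit W p) : X2.MazurMainConjectureAt W p :=
  mazurMainConjectureAt_of_bsdp_of_surjective_pow hKato hJs hJn hHs hHn hGZK hmod W p hGS h.1.ne_two
    h.1.mult (h.surjective_pow_of_surj h20 hsurj) h.1.1 (h.bsdp_of_surj_of_shaAnUnit hWu hGZK hmod hsurj hunit)

end Summit.BirchSwinnertonDyer.Rank1Residual.X11a

end
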